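import Summits.PneNP.PneNP.Theorems.ConvexRankGatesConvexGateBlindExactLiftingTrianglePlaneLocalOrth

/-!
# Triangle instance — plane-local factorisations: every plane of orthogonal weights contains a doubly balanced matrix

Support file for crux `ConvexGateBlind` (stmt-PneNP-10680), open stub `stub_exactLifting` (prover seat 3, session 22);
sequel of `…TrianglePlaneLocalOrth`.  That file shows that a weight matrix orthogonal to every atom of an
`AddSolves` dictionary has all row and column margins zero as soon as ONE admissible pair is sign-compatible with
its margins.  Here the counting consequence promised there (memo `PLANELOCAL-seat3.md` §2(b), §9(a')) is made
rigorous: the margins of the orthogonal weights form a space of dimension at most one, i.e. ANY TWO orthogonal weight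
matrices have a non-trivial linear combination that is doubly balanced (`addSolves_orth_two_dim`).  The proof is a
connectedness argument on the pencil `λ ↦ λ w₁ + w₂`: every member is doubly balanced or has a strictly one-signed
margin (`addSolves_orth_dichotomy`), the members with a strictly positive margin and those with a strictly negative
margin form two disjoint open sets, both are met for `|λ|` large (the signs follow `± w₁`), and an interval of reals
is preconnected.  Consequences (not formalised here): `dim H^⊥ ≤ dim(H^⊥ ∩ DB) + 1` and
`dim(span H ∩ Add) ≥ 2t − 2` for every solving dictionary.  Nothing here is cited; everything is elementary.
-/

set_option linter.dupNamespace false -- `Summit.PneNP.PneNP.…`: summit = sub-problem (D-0017)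

namespace Summit.PneNP.PneNP.Theorems.XorDoor.TriLine

open Finset

variable {t : ℕ}

/-- **Dichotomy.**  A weight matrix orthogonal to every atom of an `AddSolves` dictionary (`2 ≤ t`) is doubly
balanced, or its row margins are all strictly of one sign, or its column margins are all strictly of one sign. -/
theorem addSolves_orth_dichotomy {ι : Type} [Fintype ι] {H : ι → Fin t → Fin t → ℝ} (ht : 2 ≤ t)
    (hA : AddSolves H) (w : Fin t → Fin t → ℝ) (hw : ∀ i, ∑ a, ∑ d, w a d * H i a d = 0) :
    ((∀ a, ∑ d, w a d = 0) ∧ (∀ d, ∑ a, w a d = 0)) ∨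
      (∀ a, 0 < ∑ d, w a d) ∨ (∀ a, ∑ d, w a d < 0) ∨ (∀ d, 0 < ∑ a, w a d) ∨ (∀ d, ∑ a, w a d < 0) := by
  by_cases hr₁ : ∀ a, 0 < ∑ d, w a d
  · exact Or.inr (Or.inl hr₁)
  by_cases hr₂ : ∀ a, ∑ d, w a d < 0
  · exact Or.inr (Or.inr (Or.inl hr₂))
  by_cases hs₁ : ∀ d, 0 < ∑ a, w a d
  · exact Or.inr (Or.inr (Or.inr (Or.inl hs₁)))
  by_cases hs₂ : ∀ d, ∑ a, w a d < 0
  · exact Or.inr (Or.inr (Or.inr (Or.inr hs₂)))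
  left
  obtain ⟨P, hP₁, hP₂, hrP, hrN⟩ := exists_signCompatible ht (fun a => ∑ d, w a d) hr₁ hr₂
  obtain ⟨S, hS₁, hS₂, hsP, hsN⟩ := exists_signCompatible ht (fun d => ∑ a, w a d) hs₁ hs₂
  exact addSolves_orth_margins hA w hw hP₁ hP₂ hS₁ hS₂ hrP hrN hsP hsN

/-- Elementary: if `u` is strictly positive then `λ u + v` is strictly positive for all large `λ` and strictly
negative for all very negative `λ` (one explicit threshold serves every coordinate). -/
theorem exists_threshold_pos (u v : Fin t → ℝ) (hu : ∀ a, 0 < u a) :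
    ∃ Λ : ℝ, 0 ≤ Λ ∧ (∀ μ, Λ ≤ μ → ∀ a, 0 < μ * u a + v a) ∧ (∀ μ, μ ≤ -Λ → ∀ a, μ * u a + v a < 0) := by
  refine ⟨1 + ∑ b, |v b| / u b, ?_, ?_, ?_⟩
  · have : 0 ≤ ∑ b, |v b| / u b := sum_nonneg fun b _ => div_nonneg (abs_nonneg _) (le_of_lt (hu b))
    linarith
  · intro μ hμ a
    have hterm : |v a| / u a ≤ ∑ b, |v b| / u b :=
      single_le_sum (f := fun b => |v b| / u b) (fun b _ => div_nonneg (abs_nonneg _) (le_of_lt (hu b)))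
        (mem_univ a)
    have hua := hu a
    have h1 : (1 + |v a| / u a) * u a ≤ μ * u a := by
      apply mul_le_mul_of_nonneg_right _ (le_of_lt hua); linarith
    have h2 : (1 + |v a| / u a) * u a = u a + |v a| := by field_simp
    have h3 : -|v a| ≤ v a := neg_abs_le _
    linarith
  · intro μ hμ a
    have hterm : |v a| / u a ≤ ∑ b, |v b| / u b :=
      single_le_sum (f := fun b => |v b| / u b) (fun b _ => div_nonneg (abs_nonneg _) (le_of_lt (hu b)))
        (mem_univ a)
    have hua := hu a
    have h1 : μ * u a ≤ -(1 + |v a| / u a) * u a := by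
      apply mul_le_mul_of_nonneg_right _ (le_of_lt hua); linarith
    have h2 : -(1 + |v a| / u a) * u a = -(u a + |v a|) := by field_simp
    have h3 : v a ≤ |v a| := le_abs_self _
    linarith

/-- **Two orthogonal weights always combine to a doubly balanced one** (memo §9(a'), Lemma A).  If the dictionary
satisfies `AddSolves` (`2 ≤ t`) and `w₁, w₂` are both orthogonal to every atom, some non-trivial combination
`c₁ w₁ + c₂ w₂` has all row margins and all column margins equal to zero.  Hence the margin map has rank `≤ 1` on
the orthogonal complement of the span of a solving dictionary. -/
theorem addSolves_orth_two_dim {ι : Type} [Fintype ι] {H : ι → Fin t → Fin t → ℝ} (ht : 2 ≤ t)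
    (hA : AddSolves H) (w₁ w₂ : Fin t → Fin t → ℝ)
    (hw₁ : ∀ i, ∑ a, ∑ d, w₁ a d * H i a d = 0) (hw₂ : ∀ i, ∑ a, ∑ d, w₂ a d * H i a d = 0) :
    ∃ c₁ c₂ : ℝ, (c₁ ≠ 0 ∨ c₂ ≠ 0) ∧
      (∀ a, ∑ d, (c₁ * w₁ a d + c₂ * w₂ a d) = 0) ∧ (∀ d, ∑ a, (c₁ * w₁ a d + c₂ * w₂ a d) = 0) := by
  classical
  have hdich₁ := addSolves_orth_dichotomy ht hA w₁ hw₁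
  -- margins of w₁, w₂
  set r₁ : Fin t → ℝ := fun a => ∑ d, w₁ a d with hr₁
  set r₂ : Fin t → ℝ := fun a => ∑ d, w₂ a d with hr₂
  set s₁ : Fin t → ℝ := fun d => ∑ a, w₁ a d with hs₁
  set s₂ : Fin t → ℝ := fun d => ∑ a, w₂ a d with hs₂
  -- the pencil μ ↦ μ w₁ + w₂, its orthogonality and its margins
  have hW : ∀ μ : ℝ, ∀ i, ∑ a, ∑ d, (μ * w₁ a d + w₂ a d) * H i a d = 0 := by
    intro μ i
    have : ∑ a, ∑ d, (μ * w₁ a d + w₂ a d) * H i a d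
        = μ * ∑ a, ∑ d, w₁ a d * H i a d + ∑ a, ∑ d, w₂ a d * H i a d := by
      rw [mul_sum, ← sum_add_distrib]
      refine sum_congr rfl fun a _ => ?_
      rw [mul_sum, ← sum_add_distrib]
      exact sum_congr rfl fun d _ => by ring
    rw [this, hw₁ i, hw₂ i]; ring
  have hrow : ∀ μ : ℝ, ∀ a, ∑ d, (μ * w₁ a d + w₂ a d) = μ * r₁ a + r₂ a := by
    intro μ a; simp only [hr₁, hr₂, sum_add_distrib, mul_sum]
  have hcol : ∀ μ : ℝ, ∀ d, ∑ a, (μ * w₁ a d + w₂ a d) = μ * s₁ d + s₂ d := by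
    intro μ d; simp only [hs₁, hs₂, sum_add_distrib, mul_sum]
  -- total sums agree
  have htot : ∀ μ : ℝ, ∑ a, (μ * r₁ a + r₂ a) = ∑ d, (μ * s₁ d + s₂ d) := by
    intro μ
    calc ∑ a, (μ * r₁ a + r₂ a) = ∑ a, ∑ d, (μ * w₁ a d + w₂ a d) := sum_congr rfl fun a _ => (hrow μ a).symm
      _ = ∑ d, ∑ a, (μ * w₁ a d + w₂ a d) := sum_comm
      _ = ∑ d, (μ * s₁ d + s₂ d) := sum_congr rfl fun d _ => hcol μ d
  -- suppose no member of the pencil, and not w₁ itself, is doubly balanced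
  by_contra hno
  push Not at hno
  have hpencil : ∀ μ : ℝ, ¬ ((∀ a, μ * r₁ a + r₂ a = 0) ∧ (∀ d, μ * s₁ d + s₂ d = 0)) := by
    intro μ ⟨hra, hsd⟩
    obtain ⟨d, hd⟩ := hno μ 1 (Or.inr one_ne_zero) (fun a => by
      rw [show (∑ d, (μ * w₁ a d + 1 * w₂ a d)) = ∑ d, (μ * w₁ a d + w₂ a d) from
        sum_congr rfl fun d _ => by ring, hrow μ a]
      exact hra a)
    exact hd (by
      rw [show (∑ a, (μ * w₁ a d + 1 * w₂ a d)) = ∑ a, (μ * w₁ a d + w₂ a d) from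
        sum_congr rfl fun a _ => by ring, hcol μ d]
      exact hsd d)
  have hw₁nb : ¬ ((∀ a, r₁ a = 0) ∧ (∀ d, s₁ d = 0)) := by
    intro ⟨hra, hsd⟩
    obtain ⟨d, hd⟩ := hno 1 0 (Or.inl one_ne_zero) (fun a => by
      rw [show (∑ d, (1 * w₁ a d + 0 * w₂ a d)) = ∑ d, w₁ a d from sum_congr rfl fun d _ => by ring]
      exact hra a)
    exact hd (by
      rw [show (∑ a, (1 * w₁ a d + 0 * w₂ a d)) = ∑ a, w₁ a d from sum_congr rfl fun a _ => by ring]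
      exact hsd d)
  -- the two open "types"
  let Tp : Set ℝ := {μ | (∀ a, 0 < μ * r₁ a + r₂ a) ∨ (∀ d, 0 < μ * s₁ d + s₂ d)}
  let Tm : Set ℝ := {μ | (∀ a, μ * r₁ a + r₂ a < 0) ∨ (∀ d, μ * s₁ d + s₂ d < 0)}
  have hopen : ∀ (f g : Fin t → ℝ), IsOpen {μ : ℝ | ∀ a, 0 < μ * f a + g a} := by
    intro f g
    have : {μ : ℝ | ∀ a, 0 < μ * f a + g a} = ⋂ a, {μ : ℝ | 0 < μ * f a + g a} := by
      ext μ; simp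
    rw [this]
    exact isOpen_iInter_of_finite fun a => isOpen_lt continuous_const (by fun_prop)
  have hopen' : ∀ (f g : Fin t → ℝ), IsOpen {μ : ℝ | ∀ a, μ * f a + g a < 0} := by
    intro f g
    have : {μ : ℝ | ∀ a, μ * f a + g a < 0} = ⋂ a, {μ : ℝ | μ * f a + g a < 0} := by
      ext μ; simp
    rw [this]
    exact isOpen_iInter_of_finite fun a => isOpen_lt (by fun_prop) continuous_const
  have hTp : IsOpen Tp := (hopen r₁ r₂).union (hopen s₁ s₂)
  have hTm : IsOpen Tm := (hopen' r₁ r₂).union (hopen' s₁ s₂)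
  -- a fixed index (t ≥ 2)
  have a₀ : Fin t := ⟨0, by omega⟩
  -- cover: every μ has a type (dichotomy for the pencil member)
  have hcover : ∀ μ : ℝ, μ ∈ Tp ∪ Tm := by
    intro μ
    rcases addSolves_orth_dichotomy ht hA (fun a d => μ * w₁ a d + w₂ a d) (hW μ) with hdb | h | h | h | h
    · exact absurd ⟨fun a => by rw [← hrow μ a]; exact hdb.1 a, fun d => by rw [← hcol μ d]; exact hdb.2 d⟩
        (hpencil μ)
    · exact Or.inl (Or.inl fun a => by rw [← hrow μ a]; exact h a)
    · exact Or.inr (Or.inl fun a => by rw [← hrow μ a]; exact h a)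
    · exact Or.inl (Or.inr fun d => by rw [← hcol μ d]; exact h d)
    · exact Or.inr (Or.inr fun d => by rw [← hcol μ d]; exact h d)
  -- disjoint: strictly positive and strictly negative margins cannot coexist (total sums agree)
  have hdisj : ∀ μ : ℝ, μ ∈ Tp → μ ∈ Tm → False := by
    intro μ hp hm
    have hpos_r : (∀ a, 0 < μ * r₁ a + r₂ a) → 0 < ∑ a, (μ * r₁ a + r₂ a) := fun h =>
      sum_pos (fun a _ => h a) ⟨a₀, mem_univ _⟩
    have hpos_s : (∀ d, 0 < μ * s₁ d + s₂ d) → 0 < ∑ d, (μ * s₁ d + s₂ d) := fun h =>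
      sum_pos (fun d _ => h d) ⟨a₀, mem_univ _⟩
    have hneg_r : (∀ a, μ * r₁ a + r₂ a < 0) → ∑ a, (μ * r₁ a + r₂ a) < 0 := fun h =>
      sum_neg (fun a _ => h a) ⟨a₀, mem_univ _⟩
    have hneg_s : (∀ d, μ * s₁ d + s₂ d < 0) → ∑ d, (μ * s₁ d + s₂ d) < 0 := fun h =>
      sum_neg (fun d _ => h d) ⟨a₀, mem_univ _⟩
    have ht' := htot μ
    rcases hp with hp | hp <;> rcases hm with hm | hm
    · linarith [hpos_r hp, hneg_r hm]
    · linarith [hpos_r hp, hneg_s hm]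
    · linarith [hpos_s hp, hneg_r hm]
    · linarith [hpos_s hp, hneg_s hm]
  -- both types occur: the ends of the pencil follow ± w₁, which has a strictly one-signed margin
  have hends : ∃ μp μm : ℝ, μp ∈ Tp ∧ μm ∈ Tm := by
    rcases hdich₁ with hdb | h | h | h | h
    · exact absurd hdb hw₁nb
    · obtain ⟨Λ, -, hup, hdn⟩ := exists_threshold_pos r₁ r₂ h
      exact ⟨Λ, -Λ, Or.inl (hup Λ le_rfl), Or.inl (hdn (-Λ) le_rfl)⟩
    · obtain ⟨Λ, -, hup, hdn⟩ := exists_threshold_pos (fun a => - r₁ a) r₂ (fun a => by linarith [h a])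
      refine ⟨-Λ, Λ, Or.inl fun a => ?_, Or.inl fun a => ?_⟩
      · have h1 := hup Λ le_rfl a
        have e : (-Λ) * r₁ a + r₂ a = Λ * (- r₁ a) + r₂ a := by ring
        rw [e]; exact h1
      · have h1 := hdn (-Λ) le_rfl a
        have e : Λ * r₁ a + r₂ a = (-Λ) * (- r₁ a) + r₂ a := by ring
        rw [e]; exact h1
    · obtain ⟨Λ, -, hup, hdn⟩ := exists_threshold_pos s₁ s₂ h
      exact ⟨Λ, -Λ, Or.inr (hup Λ le_rfl), Or.inr (hdn (-Λ) le_rfl)⟩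
    · obtain ⟨Λ, -, hup, hdn⟩ := exists_threshold_pos (fun d => - s₁ d) s₂ (fun d => by linarith [h d])
      refine ⟨-Λ, Λ, Or.inr fun d => ?_, Or.inr fun d => ?_⟩
      · have h1 := hup Λ le_rfl d
        have e : (-Λ) * s₁ d + s₂ d = Λ * (- s₁ d) + s₂ d := by ring
        rw [e]; exact h1
      · have h1 := hdn (-Λ) le_rfl d
        have e : Λ * s₁ d + s₂ d = (-Λ) * (- s₁ d) + s₂ d := by ring
        rw [e]; exact h1
  obtain ⟨μp, μm, hμp, hμm⟩ := hends
  -- connectedness of the interval between μm and μp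
  have hconn := isPreconnected_uIcc (a := μm) (b := μp)
  have hsub : Set.uIcc μm μp ⊆ Tp ∪ Tm := fun μ _ => hcover μ
  have hne_p : (Set.uIcc μm μp ∩ Tp).Nonempty := ⟨μp, Set.right_mem_uIcc, hμp⟩
  have hne_m : (Set.uIcc μm μp ∩ Tm).Nonempty := ⟨μm, Set.left_mem_uIcc, hμm⟩
  obtain ⟨μ, -, hμ1, hμ2⟩ := hconn Tp Tm hTp hTm hsub hne_p hne_m
  exact hdisj μ hμ1 hμ2

/-- Registered form (stub `triangle_planeLocal_twoDim` of stmt-PneNP-10680): any two weight matrices orthogonal to a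
solving dictionary have a non-trivial doubly balanced linear combination (the margin map has rank `≤ 1` on `H^⊥`). -/
theorem triangle_planeLocal_twoDim : ∀ {t : ℕ} {ι : Type} [Fintype ι] {H : ι → Fin t → Fin t → ℝ}, 2 ≤ t → AddSolves H → ∀ (w₁ w₂ : Fin t → Fin t → ℝ), (∀ i, ∑ a, ∑ d, w₁ a d * H i a d = 0) → (∀ i, ∑ a, ∑ d, w₂ a d * H i a d = 0) → ∃ c₁ c₂ : ℝ, (c₁ ≠ 0 ∨ c₂ ≠ 0) ∧ (∀ a, ∑ d, (c₁ * w₁ a d + c₂ * w₂ a d) = 0) ∧ (∀ d, ∑ a, (c₁ * w₁ a d + c₂ * w₂ a d) = 0) :=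
  fun ht hA w₁ w₂ h₁ h₂ => addSolves_orth_two_dim ht hA w₁ w₂ h₁ h₂

end Summit.PneNP.PneNP.Theorems.XorDoor.TriLine
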